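import Literature.AlgebraicGeometry.HodgeTheory.SymbolClasses
import Literature.AlgebraicGeometry.HodgeTheory.HodgeFiltrationModels

/-!
# `SymbolClassesAlgebraic` (stmt-HodgeConjecture-17743) · Negative · de-Rham-invisible symbol cocycles carry only `0`

Negative knowledge for the crux `MilnorKExponential.SymbolClassesAlgebraic` (GK_p), from the
standing disprover's work file `Cruxes/SymbolClassesAlgebraic/Disproof.lean` (§8). The crux's
hypothesis `HodgeModel.HasSymbolCocycle A q c` carries the class `c` through a Čech cocycle `σ` of
holomorphic Milnor symbols and a Čech–de Rham transgression `θ` of its symbol forms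
`Σ n · dlog f₁ ∧ ⋯ ∧ dlog f_p`. The `K`-theoretic part of `σ` that `dlog` does not see (symbols of
CONSTANT units; in general `ker (dlog : 𝒦^M_p → Ω^p_cl)`, the sheaf `𝒩_p` of the route's exponential
sequence) is where a counterexample "invisible to Hodge theory" would have to hide. In weight `1`
this is impossible, and checked here: if all symbol forms of `σ` vanish on the `U_J`, the zig-zag
transgresses the ZERO cochain, the column-`0` cochain glues to a global smooth form `η` with
`dη = θ` (`exists_mextDeriv_eq_of_isTransgression_zero_zero`), so `[θ] = 0` and `c = 0`
(`eq_zero_of_invisible_symbolCocycle_one`). The general-weight statement is the injectivity half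
of the Čech–de Rham theorem (Bott–Tu (1982), Prop. 8.5/8.8: rows exact by partitions of unity); only
the gluing needed for `q = 0` is done here.
Refuter seat refuter-cdisprove-stmt-HodgeConjecture-17743-0 (cdisprove cycle 1), 2026-08-17.
-/

noncomputable section

-- The mandated namespace `Summit.<P>.<Sub>.Theorems.…` repeats `HodgeConjecture` (single-conjunct summit).
set_option linter.dupNamespace false

namespace Summit.HodgeConjecture.HodgeConjecture.Theorems.SymbolClassesAlgebraic.Negative.InvisibleCocycle

open scoped Manifold Topology ContDiff
open Filter Set
open Literature.AlgebraicGeometry.HodgeTheory Literature.AlgebraicGeometry.Motives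
  Literature.Geometry.Kaehler Literature.NumberTheory.Transcendental

section Forms

variable {E : Type*} [NormedAddCommGroup E] [NormedSpace ℝ E]
  {H : Type*} [TopologicalSpace H] {I : ModelWithCorners ℝ E H}
  {M : Type*} [TopologicalSpace M] [ChartedSpace H M] [IsManifold I ∞ M]
  {F : Type*} [NormedAddCommGroup F] [NormedSpace ℝ F]
  {ι : Type*} {U : ι → Set M} {hU : ∀ i, IsOpen (U i)}

/-- **Weight one: a transgression of the ZERO cochain over a cover is exact.** If `δ Z_{0,1} = 0`
on every `U_i ∩ U_j` then the `Z_{0,1,(i)}` glue (`apply_eq_apply_of_cechδ_eq_zero`) to a global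
smooth form `η` with `dη = θ`. [cite: BottTu1982Forms, §8 Prop. 8.5] -/
theorem exists_mextDeriv_eq_of_isTransgression_zero_zero {θ : MForm I M F (2 * 0 + 1 + 1)}
    (h : IsTransgression hU 0 (0 : (Fin (0 + 2) → ι) → MForm I M F (0 + 1)) θ)
    (hcov : ∀ x, ∃ i, x ∈ U i) :
    ∃ η : MForm I M F (2 * 0 + 1), IsSmoothForm η ∧ mextDeriv η = θ := by
  obtain ⟨Z, ht, -, hb⟩ := h
  set c : CechForms I F U 0 (2 * 0 + 1) := Z 0 (2 * 0 + 1) with hc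
  -- `δ c = 0` as a cochain: on `U_J` by the top equation, off `U_J` because cochains vanish there
  have hδ : cechδ I F hU 0 (2 * 0 + 1) c = 0 := by
    funext J
    refine Subtype.ext (funext fun x ↦ ?_)
    by_cases hx : x ∈ cechSet U J
    · exact ht J x hx
    · exact ((cechδ I F hU 0 (2 * 0 + 1) c J).2.2 x hx).trans rfl
  -- glue the components along a choice of index at each point
  choose i hi using hcov
  let η : MForm I M F (2 * 0 + 1) := fun x ↦ (c (fun _ ↦ i x) : MForm I M F (2 * 0 + 1)) x
  have hη : ∀ x, ∀ᶠ y in 𝓝 x, η y = (c (fun _ ↦ i x) : MForm I M F (2 * 0 + 1)) y := fun x ↦ by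
    filter_upwards [(hU (i x)).mem_nhds (hi x)] with y hy
    have hyJ : y ∈ cechSet U (fun _ : Fin 1 ↦ i x) := by
      rw [cechSet_fin_one]; exact hy
    exact apply_eq_apply_of_cechδ_eq_zero hU hδ (fun _ ↦ i x) (i y) (hi y) hyJ
  refine ⟨η, fun x ↦ ?_, funext fun x ↦ ?_⟩
  · have hxJ : x ∈ cechSet U (fun _ : Fin 1 ↦ i x) := by rw [cechSet_fin_one]; exact hi x
    exact (MForm.smoothAt_congr_of_eventuallyEq (hη x)).2
      ((c (fun _ ↦ i x)).2.1 x hxJ)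
  · have hxJ : x ∈ cechSet U (fun _ : Fin 1 ↦ i x) := by rw [cechSet_fin_one]; exact hi x
    rw [mextDeriv_congr_of_eventuallyEq (hη x), ← hb _ x hxJ, cechd_apply, pow_zero, one_smul,
      localD_apply_of_mem _ _ hxJ]

end Forms

variable {n : ℕ} {X : SchemeOver ℂ}

/-- **De-Rham-invisible weight-one symbol cocycles carry only the zero class.** If a class `c` is
carried (`m ≠ 0`, `A.deRham [θ] = m • A^* c`) by a weight-1 symbol cocycle `σ` whose symbol forms
`Σ n · dlog f` VANISH on every `U_J` (e.g. `σ` supported on constant units — the `K`-theoretic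
content invisible to `dlog`), then `θ` transgresses the zero cochain, hence is exact
(`exists_mextDeriv_eq_of_isTransgression_zero_zero`), `[θ] = 0` and `c = 0`. So the kernel of
`dlog` on `𝒦^M_1` contributes nothing to symbol classes beyond `0`. [cite: BottTu1982Forms, §8 Prop. 8.8] -/
theorem eq_zero_of_invisible_symbolCocycle_one (A : HodgeModel n X) {c : complexBetti X (2 * (0 + 1))}
    {ι : Type} {U : ι → Set A.carrier} (hU : ∀ i, IsOpen (U i)) (hcov : ∀ x, ∃ i, x ∈ U i)
    (σ : (Fin (0 + 2) → ι) → ((Fin (0 + 1) → (A.carrier → ℂ)) →₀ ℤ))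
    (hσ : ∀ J, ∀ x ∈ cechSet U J, symbolForm A.model (0 + 1) (σ J) x = 0)
    (θ : cclosedSmoothForms A.model A.carrier (2 * 0 + 1 + 1)) {m : ℤ} (hm : m ≠ 0)
    (hT : IsTransgression hU 0 (fun J ↦ symbolForm A.model (0 + 1) (σ J)) θ)
    (hdR : A.deRham A.carrier (2 * 0 + 1 + 1)
        (complexDeRhamCohomology.mk A.model A.carrier (2 * 0 + 1 + 1) θ) =
      (m : ℂ) • A.pullback (2 * 0 + 1 + 1) c) :
    c = 0 := by
  -- the same zig-zag transgresses the zero cochain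
  have hT0 : IsTransgression hU 0 (0 : (Fin (0 + 2) → ι) → MForm 𝓘(ℝ, A.model) A.carrier ℂ (0 + 1))
      (θ : MForm 𝓘(ℝ, A.model) A.carrier ℂ (2 * 0 + 1 + 1)) := by
    obtain ⟨Z, ht, hs, hb⟩ := hT
    exact ⟨Z, fun J x hx ↦ (ht J x hx).trans (hσ J x hx), hs, hb⟩
  obtain ⟨η, hη, hdη⟩ := exists_mextDeriv_eq_of_isTransgression_zero_zero hT0 hcov
  -- so `θ` is exact and its class vanishes
  have hθ : (θ : MForm 𝓘(ℝ, A.model) A.carrier ℂ (2 * 0 + 1 + 1)) ∈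
      cexactSmoothForms A.model A.carrier (2 * 0 + 1 + 1) :=
    Submodule.subset_span ⟨η, (mem_csmoothForms_iff η).2 hη, hdη⟩
  have hmk : complexDeRhamCohomology.mk A.model A.carrier (2 * 0 + 1 + 1) θ = 0 :=
    (Submodule.Quotient.mk_eq_zero _).2 hθ
  rw [hmk, map_zero, eq_comm, smul_eq_zero] at hdR
  rcases hdR with hm0 | h0
  · exact absurd (Int.cast_eq_zero.1 hm0) hm
  · exact A.pullback_injective (2 * 0 + 1 + 1) (by rw [h0, map_zero])

end Summit.HodgeConjecture.HodgeConjecture.Theorems.SymbolClassesAlgebraic.Negative.InvisibleCocycle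

end
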